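import Summits.QuantumFields.YangMills.Theorems.LuscherReductionRunningReductionTraceFormulaAveraging
import HarnessLib

/-!
# `physTrace` with ALL temporal links restored: the zero-flux trace `Z_phys(L, β, T)` is the twist-averaged Wilson integral on the
# `L³ × T` torus — temporal gauge fixing is exact (sub-target A2 of S-TOWER, line «twolattice», crux `TwistedTraceScaling`, stmt-QuantumFields-20203)

Route `LuscherReduction` (owner ym-beyond-p1), crux `TwistedTraceScaling` (stmt-QuantumFields-20203), line «twolattice» (sha16 a5c3dbcbf75f28d1),
lead ym-lead-20203-twolattice g0; owner LEAD-KIT (20203 evidence #16/#18) §3 A2 / J2.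

The tree's `TT.physTraceSucc L β n` (`Theorems/LuscherReductionRunningReductionTraceFormulaDefs.lean`) is, by definition, a CLOSED CHAIN of `n+1`
transfer kernels `K_β` on `n+1` time slices in TEMPORAL GAUGE: only the seam bond `U_n → U_0` carries a temporal gauge field `g` (inside `physAvg`,
together with the centre twist `z`).  A renormalisation-group treatment of S-TOWER (strategy A of the LEAD-KIT: Bałaban block-spin RG at fixed femto
size) starts instead from the FULL lattice gauge integral on the `L³ × (n+1)` torus, in which EVERY bond `U_i → U_{i+1}` carries its own temporal
gauge field `G_i : Site → SU(2)` — the bond weight `K_β(U_i, G_i · U_{i+1}) = exp(β Σₑ Re tr(U_i(e) G_i(y) U_{i+1}(e)⁻¹ G_i(x)⁻¹) − (β/2)(S(U_i)+S(U_{i+1})))`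
is exactly the product of the temporal-plaquette Boltzmann factors through the slab and half the spatial ones on its two faces (`S` gauge invariant).
This file proves that the two agree (sorry-free, standard axioms, no definitions; weights are written out):

* §1 `transferKernel_gaugeTransform_two` (`K(a·X, b·Y) = K(X, (a⁻¹b)·Y)`), prefix products
  `P_i = G_0 ⋯ G_{i−1}` of a temporal field along the chain as `List.ofFn` products (`prefixProd_zero/succ/last`).
* §2 ★ `integral_allLinks_eq_of_telescope` / ★ `integral_allLinks_eq`: **temporal gauge fixing is exact, POINTWISE in the temporal links** — for every
  `Gs : Fin (n+1) → (Site → SU(2))`,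
  `∫ ∏_{i<n} K(U_i, G_i·U_{i+1}) · K(U_n, G_n·tw_z U_0) dU = ∫ ∏_{i<n} K(U_i, U_{i+1}) · K(U_n, (G_0 G_1 ⋯ G_n)·tw_z U_0) dU`,
  by ONE measure-preserving coordinatewise change of variables `U_i ↦ P_i⁻¹ · U_i` on the product of a-priori measures (`measurePreserving_pi` +
  `measurePreserving_gaugeTransform_configMeasure`) and the covariance `K(h·U, h·V) = K(U, V)` — the accumulated holonomy of the temporal links lands on
  the seam bond, where `physAvg` integrates it out.
* §3 ★ `physTraceSucc_eq_sum_integral_seam`: the definition unfolded by one Fubini — `Z_phys(L,β,n+1) = (1/8) Σ_z ∫ dg ∫ dU ∏_{i<n} K(U_i,U_{i+1}) · K(U_n, g·tw_z U_0)`.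

Consequence (J2 of the LEAD-KIT, now kernel-level): for every assignment of temporal links the all-links closed-chain integral equals the seam-only one with
seam field `G_0⋯G_n`; averaging the seam field over the gauge group and the twist over `(ℤ/2)³` gives `physTraceSucc` (§3).  The remaining packaging
«average over ALL `n+1` temporal fields = average over the one seam field» is the statement that the ordered product of independent Haar elements is
Haar distributed (left to the consumer; not needed pointwise).

HONEST FRAMING: carrier bookkeeping for the femto rung R2b1 (what the 4D RG acts on); no estimate, no RG content; not infinite volume, not a gap, not Clay.
-/

set_option autoImplicit false

noncomputable section

open MeasureTheory Filter Topology Real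
open Literature.MathematicalPhysics.QuantumFieldTheory
open Literature.MathematicalPhysics.QuantumLattice
open scoped BigOperators

namespace Summit.QuantumFields.YangMills.Theorems.FemtoTransferGap.TwoLattice.TowerA

open Summit.QuantumFields.YangMills.Theorems.FemtoTransferGap
open Summit.QuantumFields.YangMills.Theorems.FemtoTransferGap.TT

variable {L : ℕ} [NeZero L]

/-! ## §1 Generic change of variables, kernel covariance with two gauge fields, prefix products -/

/-- Kernel covariance with two different gauge fields: `K(a·X, b·Y) = K(X, (a⁻¹ b)·Y)`. [cite: SeilerLNP1982, §3] -/
theorem transferKernel_gaugeTransform_two (β : ℝ) (a b : Site 3 L → SU2) (X Y : GaugeConfig 3 L SU2) :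
    transferKernel su2Rep β (gaugeTransform a X) (gaugeTransform b Y) = transferKernel su2Rep β X (gaugeTransform (a⁻¹ * b) Y) := by
  conv_lhs => rw [show gaugeTransform b Y = gaugeTransform a (gaugeTransform (a⁻¹ * b) Y) by
    rw [gaugeTransform_gaugeTransform, ← mul_assoc, mul_inv_cancel, one_mul]]
  exact transferKernel_gaugeTransform su2Rep β a X _

omit [NeZero L] in
/-- Prefix products of a temporal field along the chain: `P_0 = 1`. [folklore] -/
theorem prefixProd_zero {n : ℕ} (Gs : Fin (n + 1) → Site 3 L → SU2) :
    (List.ofFn fun j : Fin ((0 : Fin (n + 1)) : ℕ) => Gs (Fin.castLE (0 : Fin (n + 1)).isLt.le j)).prod = 1 := by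
  simp

omit [NeZero L] in
/-- Prefix products: `P_{i+1} = P_i · G_i`. [folklore] -/
theorem prefixProd_succ {n : ℕ} (Gs : Fin (n + 1) → Site 3 L → SU2) (i : Fin n) :
    (List.ofFn fun j : Fin ((i.succ : Fin (n + 1)) : ℕ) => Gs (Fin.castLE i.succ.isLt.le j)).prod =
      (List.ofFn fun j : Fin ((i.castSucc : Fin (n + 1)) : ℕ) => Gs (Fin.castLE i.castSucc.isLt.le j)).prod * Gs i.castSucc := by
  have hv : ((i.succ : Fin (n + 1)) : ℕ) = (i : ℕ) + 1 := rfl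
  have hc : ((i.castSucc : Fin (n + 1)) : ℕ) = (i : ℕ) := rfl
  -- rewrite the left list as a `concat`
  have key : (List.ofFn fun j : Fin ((i : ℕ) + 1) => Gs (Fin.castLE i.succ.isLt.le j)).prod =
      (List.ofFn fun j : Fin (i : ℕ) => Gs (Fin.castLE i.castSucc.isLt.le j)).prod * Gs i.castSucc := by
    rw [List.ofFn_succ', List.prod_concat]
    congr 1
  exact key

omit [NeZero L] in
/-- Prefix products: `P_n · G_n = G_0 G_1 ⋯ G_n` (the full ordered product). [folklore] -/
theorem prefixProd_last {n : ℕ} (Gs : Fin (n + 1) → Site 3 L → SU2) :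
    (List.ofFn fun j : Fin ((Fin.last n : Fin (n + 1)) : ℕ) => Gs (Fin.castLE (Fin.last n).isLt.le j)).prod * Gs (Fin.last n) =
      (List.ofFn Gs).prod := by
  have key : (List.ofFn Gs).prod = (List.ofFn fun j : Fin n => Gs (Fin.castLE (Fin.last n).isLt.le j)).prod * Gs (Fin.last n) := by
    rw [List.ofFn_succ', List.prod_concat]
    congr 1
  exact key.symm

/-! ## §2 ★ Temporal gauge fixing is exact, pointwise in the temporal links -/

/-- Measurability of the all-links closed-chain weight (as a function of the spatial slices, temporal links fixed). [folklore] -/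
theorem measurable_transferKernel_comp {β : ℝ} {n : ℕ} {f g : (Fin (n + 1) → GaugeConfig 3 L SU2) → GaugeConfig 3 L SU2}
    (hf : Measurable f) (hg : Measurable g) :
    Measurable fun Us : Fin (n + 1) → GaugeConfig 3 L SU2 => transferKernel su2Rep β (f Us) (g Us) := by
  have hK : Measurable (Function.uncurry fun U V : GaugeConfig 3 L SU2 => transferKernel su2Rep β U V) :=
    (PhysL2.stronglyMeasurable_transferKernel (L := L) β).measurable
  have h2 : Measurable ((Function.uncurry fun U V : GaugeConfig 3 L SU2 => transferKernel su2Rep β U V) ∘ fun Us => (f Us, g Us)) :=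
    hK.comp (hf.prodMk hg)
  exact h2

/-- Measurability of the all-links closed-chain weight (as a function of the spatial slices, temporal links fixed). [folklore] -/
theorem measurable_allLinksWeight (β : ℝ) (z : Fin 3 → Bool) (n : ℕ) (Gs : Fin (n + 1) → Site 3 L → SU2) :
    Measurable fun Us : Fin (n + 1) → GaugeConfig 3 L SU2 =>
      (∏ i : Fin n, transferKernel su2Rep β (Us i.castSucc) (gaugeTransform (Gs i.castSucc) (Us i.succ))) *
        transferKernel su2Rep β (Us (Fin.last n)) (gaugeTransform (Gs (Fin.last n)) (twist3 z (Us 0))) := by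
  have hg : ∀ g : Site 3 L → SU2, Measurable (gaugeTransform g : GaugeConfig 3 L SU2 → GaugeConfig 3 L SU2) :=
    fun g => (measurePreserving_gaugeTransform_configMeasure g).measurable
  have hπ : ∀ i : Fin (n + 1), Measurable fun Us : Fin (n + 1) → GaugeConfig 3 L SU2 => Us i := fun i => measurable_pi_apply i
  refine Measurable.mul (Finset.measurable_prod _ fun i _ => ?_) ?_
  · exact measurable_transferKernel_comp (hπ i.castSucc) ((hg (Gs i.castSucc)).comp (hπ i.succ))
  · exact measurable_transferKernel_comp (hπ (Fin.last n)) ((hg (Gs (Fin.last n))).comp ((measurable_twist3 z).comp (hπ 0)))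

/-- **Temporal gauge fixing from a telescoping certificate.**  If `h : Fin (n+1) → (Site → SU(2))` satisfies `h 0 = 1` and
`G_i · h_{i+1} = h_i` along the chain, then the coordinatewise change of variables `U_i ↦ h_i · U_i` turns the all-links weight into the seam-only
weight with seam field `h_n⁻¹ G_n`. [cite: SeilerLNP1982, §3] [cite: MontvayMunster1994, (3.145)] -/
theorem integral_allLinks_eq_of_telescope (β : ℝ) (z : Fin 3 → Bool) (n : ℕ) (Gs h : Fin (n + 1) → Site 3 L → SU2)
    (h0 : h 0 = 1) (hstep : ∀ i : Fin n, Gs i.castSucc * h i.succ = h i.castSucc) :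
    ∫ Us, (∏ i : Fin n, transferKernel su2Rep β (Us i.castSucc) (gaugeTransform (Gs i.castSucc) (Us i.succ))) *
        transferKernel su2Rep β (Us (Fin.last n)) (gaugeTransform (Gs (Fin.last n)) (twist3 z (Us 0)))
        ∂(Measure.pi fun _ : Fin (n + 1) => configMeasure SU2 L) =
      ∫ Us, (∏ i : Fin n, transferKernel su2Rep β (Us i.castSucc) (Us i.succ)) *
        transferKernel su2Rep β (Us (Fin.last n)) (gaugeTransform ((h (Fin.last n))⁻¹ * Gs (Fin.last n)) (twist3 z (Us 0)))
        ∂(Measure.pi fun _ : Fin (n + 1) => configMeasure SU2 L) := by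
  haveI : SecondCountableTopology SU2 := secondCountableTopology_su2
  -- the coordinatewise substitution
  set Θ : (Fin (n + 1) → GaugeConfig 3 L SU2) → (Fin (n + 1) → GaugeConfig 3 L SU2) :=
    fun Us i => gaugeTransform (h i) (Us i) with hΘ
  have hMP : MeasurePreserving Θ (Measure.pi fun _ : Fin (n + 1) => configMeasure SU2 L)
      (Measure.pi fun _ : Fin (n + 1) => configMeasure SU2 L) :=
    measurePreserving_pi (fun _ : Fin (n + 1) => configMeasure SU2 L) (fun _ : Fin (n + 1) => configMeasure SU2 L)
      (fun i => measurePreserving_gaugeTransform_configMeasure (h i))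
  -- change of variables (no integrability needed: both sides are the same Bochner integral after `map Θ μ = μ`)
  have hcov : ∀ {F : (Fin (n + 1) → GaugeConfig 3 L SU2) → ℝ}, Measurable F →
      ∫ Us, F (Θ Us) ∂(Measure.pi fun _ : Fin (n + 1) => configMeasure SU2 L) =
        ∫ Us, F Us ∂(Measure.pi fun _ : Fin (n + 1) => configMeasure SU2 L) := by
    intro F hF
    have h := integral_map (μ := Measure.pi fun _ : Fin (n + 1) => configMeasure SU2 L) hMP.measurable.aemeasurable (f := F)
      hF.aestronglyMeasurable
    rw [hMP.map_eq] at h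
    exact h.symm
  rw [← hcov (measurable_allLinksWeight β z n Gs)]
  refine integral_congr_ae (ae_of_all _ fun Us => ?_)
  -- pointwise algebra
  have hfac : ∀ i : Fin n, transferKernel su2Rep β (Θ Us i.castSucc) (gaugeTransform (Gs i.castSucc) (Θ Us i.succ)) =
      transferKernel su2Rep β (Us i.castSucc) (Us i.succ) := by
    intro i
    simp only [hΘ]
    rw [gaugeTransform_gaugeTransform, transferKernel_gaugeTransform_two, ← hstep i, inv_mul_cancel, gaugeTransform_one']
  have hseam : transferKernel su2Rep β (Θ Us (Fin.last n)) (gaugeTransform (Gs (Fin.last n)) (twist3 z (Θ Us 0))) =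
      transferKernel su2Rep β (Us (Fin.last n)) (gaugeTransform ((h (Fin.last n))⁻¹ * Gs (Fin.last n)) (twist3 z (Us 0))) := by
    simp only [hΘ]
    rw [h0, gaugeTransform_one', transferKernel_gaugeTransform_two]
  simp only [hfac, hseam]

/-- ★ **Temporal gauge fixing is exact (all temporal links ↦ one seam link), pointwise in the temporal links.**  For every temporal field
`Gs` on the `n+1` bonds of the closed chain, the all-links integral over the spatial slices equals the seam-only integral with seam field the
ORDERED PRODUCT `G_0 G_1 ⋯ G_n` (`(List.ofFn Gs).prod`).  Certificate: `h_i = (G_0⋯G_{i−1})⁻¹` in `integral_allLinks_eq_of_telescope`.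
[cite: SeilerLNP1982, §3] [cite: MontvayMunster1994, (3.145)] -/
theorem integral_allLinks_eq (β : ℝ) (z : Fin 3 → Bool) (n : ℕ) (Gs : Fin (n + 1) → Site 3 L → SU2) :
    ∫ Us, (∏ i : Fin n, transferKernel su2Rep β (Us i.castSucc) (gaugeTransform (Gs i.castSucc) (Us i.succ))) *
        transferKernel su2Rep β (Us (Fin.last n)) (gaugeTransform (Gs (Fin.last n)) (twist3 z (Us 0)))
        ∂(Measure.pi fun _ : Fin (n + 1) => configMeasure SU2 L) =
      ∫ Us, (∏ i : Fin n, transferKernel su2Rep β (Us i.castSucc) (Us i.succ)) *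
        transferKernel su2Rep β (Us (Fin.last n)) (gaugeTransform (List.ofFn Gs).prod (twist3 z (Us 0)))
        ∂(Measure.pi fun _ : Fin (n + 1) => configMeasure SU2 L) := by
  set h : Fin (n + 1) → Site 3 L → SU2 :=
    fun i => ((List.ofFn fun j : Fin (i : ℕ) => Gs (Fin.castLE i.isLt.le j)).prod)⁻¹ with hh
  have h0 : h 0 = 1 := by
    simp only [hh]; rw [inv_eq_one]; exact prefixProd_zero Gs
  have hstep : ∀ i : Fin n, Gs i.castSucc * h i.succ = h i.castSucc := by
    intro i
    simp only [hh]
    rw [prefixProd_succ Gs i, mul_inv_rev, ← mul_assoc, mul_inv_cancel, one_mul]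
  have hlast : (h (Fin.last n))⁻¹ * Gs (Fin.last n) = (List.ofFn Gs).prod := by
    simp only [hh]; rw [inv_inv]; exact prefixProd_last Gs
  rw [integral_allLinks_eq_of_telescope β z n Gs h h0 hstep, hlast]

/-! ## §3 ★ `physTraceSucc` unfolded: the seam-only form with the seam gauge field and the twist outermost -/

/-- Uniform bound of the seam-only chain weight: `|∏_{i<n} K(U_i,U_{i+1}) · K(U_n, W)| ≤ M^{n+1}`. [folklore] -/
theorem abs_seamWeight_le {β M : ℝ} (hM0 : 0 ≤ M) (hM : ∀ U V : GaugeConfig 3 L SU2, ‖transferKernel su2Rep β U V‖ ≤ M)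
    {n : ℕ} (Us : Fin (n + 1) → GaugeConfig 3 L SU2) (W : GaugeConfig 3 L SU2) :
    ‖(∏ i : Fin n, transferKernel su2Rep β (Us i.castSucc) (Us i.succ)) * transferKernel su2Rep β (Us (Fin.last n)) W‖ ≤
      M ^ n * M := by
  rw [norm_mul, norm_prod]
  refine mul_le_mul ?_ (hM _ _) (norm_nonneg _) (pow_nonneg hM0 n)
  calc ∏ i : Fin n, ‖transferKernel su2Rep β (Us i.castSucc) (Us i.succ)‖ ≤ ∏ _i : Fin n, M :=
        Finset.prod_le_prod (fun i _ => norm_nonneg _) (fun i _ => hM _ _)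
    _ = M ^ n := by rw [Finset.prod_const, Finset.card_univ, Fintype.card_fin]

/-- Joint measurability of the seam-only weight in (slices, seam gauge field). [folklore] -/
theorem measurable_seamWeight_uncurry (β : ℝ) (z : Fin 3 → Bool) (n : ℕ) :
    Measurable (Function.uncurry fun (Us : Fin (n + 1) → GaugeConfig 3 L SU2) (g : Site 3 L → SU2) =>
      (∏ i : Fin n, transferKernel su2Rep β (Us i.castSucc) (Us i.succ)) *
        transferKernel su2Rep β (Us (Fin.last n)) (gaugeTransform g (twist3 z (Us 0)))) := by
  have hK : Measurable (fun p : GaugeConfig 3 L SU2 × GaugeConfig 3 L SU2 => transferKernel su2Rep β p.1 p.2) :=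
    (PhysL2.stronglyMeasurable_transferKernel (L := L) β).measurable
  have hG : Measurable (fun p : (Site 3 L → SU2) × GaugeConfig 3 L SU2 => gaugeTransform p.1 p.2) :=
    measurable_gaugeTransform_uncurry (L := L)
  have hT : Measurable (twist3 (L := L) z) := measurable_twist3 z
  simp only [Function.uncurry_def]
  fun_prop

/-- ★ **`Z_phys` with the seam gauge field and the twist outermost** (the definition of `physTraceSucc` with `physAvg` unfolded and ONE Fubini):
`physTraceSucc L β n = (1/8) Σ_z ∫ dg ∫ dU ∏_{i<n} K(U_i, U_{i+1}) · K(U_n, g·tw_z U_0)`.  Combined with `integral_allLinks_eq`, every assignment of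
temporal links to the `n+1` bonds gives the same slice integral as the single seam field `G_0⋯G_n`. [cite: MontvayMunster1994, (3.145)] [cite: Luscher1983, §2] -/
theorem physTraceSucc_eq_sum_integral_seam (β : ℝ) (n : ℕ) :
    physTraceSucc L β n = (1 / 8 : ℝ) * ∑ z : Fin 3 → Bool, ∫ g, ∫ Us,
      (∏ i : Fin n, transferKernel su2Rep β (Us i.castSucc) (Us i.succ)) *
        transferKernel su2Rep β (Us (Fin.last n)) (gaugeTransform g (twist3 z (Us 0)))
        ∂(Measure.pi fun _ : Fin (n + 1) => configMeasure SU2 L) ∂gaugeMeasure L := by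
  haveI := isProbabilityMeasure_gaugeMeasure (L := L)
  obtain ⟨M, hM0, hM⟩ := PhysL2.exists_norm_transferKernel_le (L := L) β
  -- pointwise: pull the product inside the average
  have hpt : ∀ Us : Fin (n + 1) → GaugeConfig 3 L SU2,
      (∏ i : Fin n, transferKernel su2Rep β (Us i.castSucc) (Us i.succ)) *
          physAvg (transferKernel su2Rep β (Us (Fin.last n))) (Us 0) =
        (1 / 8 : ℝ) * ∑ z : Fin 3 → Bool, ∫ g,
          (∏ i : Fin n, transferKernel su2Rep β (Us i.castSucc) (Us i.succ)) *
            transferKernel su2Rep β (Us (Fin.last n)) (gaugeTransform g (twist3 z (Us 0))) ∂gaugeMeasure L := by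
    intro Us
    unfold physAvg
    rw [mul_left_comm, Finset.mul_sum]
    congr 1
    refine Finset.sum_congr rfl fun z _ => ?_
    rw [← integral_const_mul]
  -- integrability of each twisted term on the product space
  have hint : ∀ z : Fin 3 → Bool, Integrable (Function.uncurry fun (Us : Fin (n + 1) → GaugeConfig 3 L SU2) (g : Site 3 L → SU2) =>
      (∏ i : Fin n, transferKernel su2Rep β (Us i.castSucc) (Us i.succ)) *
        transferKernel su2Rep β (Us (Fin.last n)) (gaugeTransform g (twist3 z (Us 0))))
      ((Measure.pi fun _ : Fin (n + 1) => configMeasure SU2 L).prod (gaugeMeasure L)) := by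
    intro z
    refine Integrable.of_bound (measurable_seamWeight_uncurry β z n).aestronglyMeasurable (M ^ n * M) (ae_of_all _ fun p => ?_)
    rw [Function.uncurry_apply_pair]
    exact abs_seamWeight_le hM0 hM p.1 _
  -- integrability of the `g`-averaged terms on the slice space
  have hint' : ∀ z : Fin 3 → Bool, Integrable (fun Us : Fin (n + 1) → GaugeConfig 3 L SU2 => ∫ g,
      (∏ i : Fin n, transferKernel su2Rep β (Us i.castSucc) (Us i.succ)) *
        transferKernel su2Rep β (Us (Fin.last n)) (gaugeTransform g (twist3 z (Us 0))) ∂gaugeMeasure L)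
      (Measure.pi fun _ : Fin (n + 1) => configMeasure SU2 L) := fun z => (hint z).integral_prod_left
  unfold physTraceSucc
  simp_rw [hpt]
  rw [integral_const_mul, integral_finsetSum _ fun z _ => hint' z]
  congr 1
  refine Finset.sum_congr rfl fun z _ => ?_
  exact integral_integral_swap (hint z)

end Summit.QuantumFields.YangMills.Theorems.FemtoTransferGap.TwoLattice.TowerA

end
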